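import Literature.NumberTheory.Automorphic.Liu2021.AppendixC.EtaleHeckeDatumOfTranslates
import HarnessLib

/-!
# [Liu 2021, Thm 4.15 / 4.18] RECEPTACLE: a morphism of towers `{S̃h(G⋆)_{K⋆}} → {S̃h(G)_K}` over `E` along a group map
# `φ : G⋆(𝔸_F^∞) → G(𝔸_F^∞)`, and its pull-back on the `ℓ`-adic towers `H¹_ét(A_∞)` (typer row T2-R3 of the cell's LIU415-SPEC §7)

Topic `NumberTheory/Automorphic/Liu2021/AppendixC`; namespace `Literature.NumberTheory.Automorphic.Liu2021.AppendixC`.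
An INTERFACE (two hypothesis structures + real definitions + bookkeeping theorems); NO named fact, NO instance, NO notation,
NO `sorry`; net Literature debt 0; nothing of [Liu2021] is asserted.  Cell `hodgecm-mathlib`, crux `HLiu418`
(stmt-HodgeConjecture-24832), residual `stub_S_thm415Frobenius` (III-9′ (S)): the printed proof of [Liu2021] Thm 4.15 at the
face restricts classes of `H¹_ét(A_∞)` for `𝔾 = U(𝕍)` ALONG THE `E`-MORPHISM OF TOWERS induced by the sub-datum
`U(V⋆) × U(V⋆^⊥) ↪ U(V)` (READFIRST/LIU415-SPEC §3 (S5) «Galois-equivariant restriction along the E-morphism of towers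
(unprinted; [Deligne 1971] 5.4)»; [Milne2005ShimuraVarieties] Thm. 13.6: a morphism of Shimura data `φ : (G⋆, X⋆) → (G, X)`
induces, for `φ(K⋆) ⊆ K`, morphisms `Sh_{K⋆}(G⋆, X⋆) → Sh_K(G, X)` of the canonical models over the reflex field, compatible
with the Hecke operators).  The rank-2 sub-datum itself (typer rows T2-R1/T2-R2) is NOT in the tree; this file types the
RECEPTACLE over two arbitrary §4.2 data `Cₛ : Sec42Data P5ₛ isoₛ`, `C : Sec42Data P5 iso` over the same CM extension `E/F`
with Hecke translates `Tₛ`, `T` and a continuous group map `φ : Cₛ.G →* C.G` — the object S5 quantifies over.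

## Contents

* §1 (group-generic, reusable by the I-1′ receptacle of `F1ExtHodgeType`) **`C5.pullbackLevel φ hφ K := φ⁻¹(K) ∩ K₀⋆`** —
  the CANONICAL sufficiently small source level for a target level `K` (open: `φ` continuous; compact: closed in `K₀⋆`; the
  construction of `C5.heckeLevel`), with `map_pullbackLevel_le : φ(φ⁻¹K ∩ K₀⋆) ⊆ K`, monotonicity, the transfer of the level
  condition at `g = 1` and for `g ∈ K₀⋆`, and the refinement `heckeLevel_pullbackLevel_le` used by the Hecke intertwining.
* §2 **`Sec42Data.TowerHom Cₛ C Tₛ T φ hφ`** — the geometric datum: `map K : X⋆_{φ⁻¹K ∩ K₀⋆} ⟶ X_K` for every small `K`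
  ([Milne05] Thm. 13.6 «`Sh(φ) : Sh_{K⋆} → Sh_K` for `φ(K⋆) ⊆ K`»), compatible with ALL admissible Hecke translates
  from every admissible source level (`map_tr`: `u⋆ ≫ map L ≫ T_{φ g} = T⋆_g ≫ map K`; in particular with the transition
  morphisms, `map_comm`).  DERIVED (real):
  `albMap K := Alb(map K) : A⋆_{φ⁻¹K ∩ K₀⋆} ⟶ A_K` (★ `Albanese.map`), the printed square `α_albMap`, `albMap_albTr`
  (`Alb` of `map_tr`, ★ `Albanese.map_comp`), and the level pull-back on `H¹_ét = (V_ℓ)^∨`,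
  `etPullLevel ℓ K := ᵗV_ℓ(albMap K)`, with its `Γ_E`-equivariance `etaleH1Rep_comp_etPullLevel`.
* §3 **`Sec42Data.EtaleTowerHom … extends TowerHom`** — adds the pull-back `etPull ℓ : H¹_ét(A_∞) →ₗ H¹_ét(A⋆_∞)` on the
  colimits with ONE law, the defining square `etPull_toTower` (`etPull [ψ]_K = [ᵗV_ℓ(Alb(map K)) ψ]_{φ⁻¹K ∩ K₀⋆}`).  DERIVED:
  **`etPull_towerRep`** — `Γ_E`-equivariance (every class is a level class, ★ `exists_eq_toTower`; the square;
  `etaleH1Rep_comp_etPullLevel`; ★ `towerRep_toTower`); **`etPull_etHeckeRep`** — the Hecke intertwining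
  `etPull ∘ (φ g)· = g· ∘ etPull`, granted `φ(K₀⋆) ⊆ K₀` (from `map_tr` at the refined source level
  `g(φ⁻¹K ∩ K₀⋆)g⁻¹ ∩ K₀⋆ ⊆ φ⁻¹((φ g)K(φ g)⁻¹ ∩ K₀) ∩ K₀⋆`, `C5.heckeLevel_pullbackLevel_le`); **`etPull_unique`** — the square
  alone pins `etPull`.  So the étale receptacle posits NO law beyond the square.
* NOT here (say so): the existence statement `Nonempty (Sec42Data.EtaleTowerHom …)` for the printed sub-datum
  `U(V⋆) × U(V⋆^⊥) ↪ U(V)` — it needs the rank-2 / product `PropC5Data`+`IncoherentShimuraSystem` of typer rows T2-R1/T2-R2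
  (LIU415-SPEC §7), absent today; and the construction of `etPull` from `map` by `Module.DirectLimit.lift` (routine once wanted;
  the interface keeps it a field pinned by `etPull_unique`).

## References
* [Liu2021] Y. Liu, *Fourier–Jacobi cycles and arithmetic relative trace formula*, Camb. J. Math. 9 (2021) = arXiv:2102.11518:
  §4.2 l. 2060–2074, §4.3 l. 2152–2160, Thm. 4.15 and the proof of Thm. 4.18 l. 2258–2290.
* [Milne2005ShimuraVarieties] J. S. Milne, *Introduction to Shimura varieties* (2005), §5 p. 57–58 (inverse systems with
  `G(𝔸_f)`-action, Def. 5.14), §13 p. 118 L21–28, Thm. 13.6 p. 118 (rationality of `T(g)`) and Rem. 13.8 p. 119 (morphisms of Shimura data induce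
  morphisms of canonical models over the compositum of the reflex fields).
* [Deligne1971TravauxShimura] P. Deligne, *Travaux de Shimura*, Sém. Bourbaki 389 (1971), §5 (5.4: morphisms of canonical models).
* Tree: `AppendixC.Glue` (`Sec42Data`), `AppendixC.HeckeTranslates`, `AppendixC.AlbaneseFunctorial` (`Albanese.map`),
  `AppendixC.EtaleH1Tower`, `AppendixC.EtaleHeckeDatumOfTranslates` (`etHeckeRep`, `exists_eq_toTower`),
  `Motives.TateAbelianFiniteSteps` (`rationalTateModuleMap_comp`, `rationalTateRep_rationalTateModuleMap`).
-/

set_option autoImplicit false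

noncomputable section

open CategoryTheory NumberField
open scoped TensorProduct

namespace Literature.NumberTheory.Automorphic.Liu2021.AppendixC

open Literature.AlgebraicGeometry.Motives (AbelianVariety)
open Literature.AlgebraicGeometry.Motives.AbelianVariety (rationalTateModuleMap rationalTateModuleMap_comp
  rationalTateRep_rationalTateModuleMap)

/-! ## §1 The canonical source level `φ⁻¹(K) ∩ K₀⋆` of a target level (group-generic) -/

namespace C5

variable {H H' : Type} [Group H] [TopologicalSpace H] [Group H'] [TopologicalSpace H'] [IsTopologicalGroup H']
variable {K₀ : OpenCompactSubgroup H} {K₀' : OpenCompactSubgroup H'} (φ : H →* H') (hφ : Continuous φ)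

/-- **The pull-back level `φ⁻¹(K) ∩ K₀⋆`** of a sufficiently small level `K ⊆ K₀'` of `H'` along a continuous group map
`φ : H → H'`: a sufficiently small level of `H` (open as the preimage of an open subgroup under a continuous map, compact as a
closed subset of the compact `K₀`).  The canonical source of the morphism `Sh_{K⋆}(G⋆) → Sh_K(G)`, `φ(K⋆) ⊆ K`, of
[Milne2005ShimuraVarieties] Thm. 13.6 inside the systems indexed by the `K ⊆ K₀` of [Liu2021] Prop. C.5.
[cite: Milne2005ShimuraVarieties, Rem. 13.8 p. 119 and §13 p. 118 L21–28] [cite: Liu2021, Prop. C.5 l. 4627–4628] -/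
def pullbackLevel (K₀ : OpenCompactSubgroup H) (K : SmallLevel K₀') : SmallLevel K₀ :=
  ⟨⟨K.1.1.comap φ ⊓ K₀.1, by
      refine ⟨?_, ?_⟩
      · rw [Subgroup.coe_inf, Subgroup.coe_comap]
        exact (K.1.2.1.preimage hφ).inter K₀.2.1
      · rw [Subgroup.coe_inf, Subgroup.coe_comap]
        exact K₀.2.2.inter_left ((Subgroup.isClosed_of_isOpen _ K.1.2.1).preimage hφ)⟩,
    (inf_le_right : K.1.1.comap φ ⊓ K₀.1 ≤ K₀.1)⟩

/-- The underlying subgroup of the pull-back level is `φ⁻¹(K) ∩ K₀` (by `rfl`). [cite: Milne2005ShimuraVarieties, Rem. 13.8 p. 119 and Thm. 13.6 p. 118] -/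
theorem pullbackLevel_val (K : SmallLevel K₀') :
    ((pullbackLevel φ hφ K₀ K).1.1 : Subgroup H) = K.1.1.comap φ ⊓ K₀.1 := rfl

/-- Membership in the pull-back level: `k ∈ φ⁻¹(K) ∩ K₀ ↔ φ k ∈ K ∧ k ∈ K₀`. [cite: Milne2005ShimuraVarieties, Rem. 13.8 p. 119 and Thm. 13.6 p. 118] -/
theorem mem_pullbackLevel_iff (K : SmallLevel K₀') (k : H) :
    k ∈ (pullbackLevel φ hφ K₀ K).1.1 ↔ φ k ∈ K.1.1 ∧ k ∈ K₀.1 := by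
  rw [pullbackLevel_val, Subgroup.mem_inf, Subgroup.mem_comap]

/-- **`φ(φ⁻¹K ∩ K₀) ⊆ K`** — the level condition «`φ(K⋆) ⊆ K`» of [Milne2005ShimuraVarieties] Thm. 13.6 holds for the
pull-back level. [cite: Milne2005ShimuraVarieties, Rem. 13.8 p. 119 and Thm. 13.6 p. 118] -/
theorem map_pullbackLevel_le (K : SmallLevel K₀') : (pullbackLevel φ hφ K₀ K).1.1.map φ ≤ K.1.1 := by
  rw [pullbackLevel_val, Subgroup.map_le_iff_le_comap]
  exact inf_le_left

/-- The pull-back level is monotone in the target level. [cite: Milne2005ShimuraVarieties, §5 p. 58 L3–6] -/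
theorem pullbackLevel_mono {K K' : SmallLevel K₀'} (h : K ≤ K') : pullbackLevel φ hφ K₀ K ≤ pullbackLevel φ hφ K₀ K' := by
  show (pullbackLevel φ hφ K₀ K).1.1 ≤ (pullbackLevel φ hφ K₀ K').1.1
  rw [pullbackLevel_val, pullbackLevel_val]
  exact inf_le_inf_right _ (Subgroup.comap_mono (show K.1.1 ≤ K'.1.1 from h))

/-- The level condition at `g = 1` transfers along `φ`: `K ⊆ K'` gives `HeckeLE 1 (φ⁻¹K ∩ K₀) (φ⁻¹K' ∩ K₀)`.
[cite: Milne2005ShimuraVarieties, §13 p. 118 L21 and Thm. 13.7 (a) p. 119] -/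
theorem heckeLE_one_pullbackLevel {K K' : SmallLevel K₀'} (h : K ≤ K') :
    HeckeLE (1 : H) (pullbackLevel φ hφ K₀ K) (pullbackLevel φ hφ K₀ K') :=
  HeckeLE.one_of_le (pullbackLevel_mono φ hφ h)

/-- **`g(φ⁻¹K ∩ K₀)g⁻¹ ∩ K₀ ⊆ φ⁻¹((φ g) K (φ g)⁻¹ ∩ K₀') ∩ K₀`** when `φ(K₀) ⊆ K₀'`: the canonical source level of the
translate `T⋆_g` into `φ⁻¹K ∩ K₀` (★ `C5.heckeLevel`) refines the pull-back of the canonical source level of `T_{φ g}` into `K`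
— the level bookkeeping behind the Hecke intertwining of the pull-back on `H¹_ét` (`EtaleTowerHom.etPull_etHeckeRep`).
[cite: Milne2005ShimuraVarieties, §13 p. 118 L21–26 and Rem. 13.8 p. 119] -/
theorem heckeLevel_pullbackLevel_le [IsTopologicalGroup H] (hK₀ : K₀.1.map φ ≤ K₀'.1) (g : H) (K : SmallLevel K₀') :
    heckeLevel g (pullbackLevel φ hφ K₀ K) ≤ pullbackLevel φ hφ K₀ (heckeLevel (φ g) K) := by
  show (heckeLevel g (pullbackLevel φ hφ K₀ K)).1.1 ≤ (pullbackLevel φ hφ K₀ (heckeLevel (φ g) K)).1.1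
  intro k hk
  rw [heckeLevel_val, Subgroup.mem_inf, Subgroup.mem_map] at hk
  obtain ⟨⟨k', hk', rfl⟩, hk₀⟩ := hk
  rw [mem_pullbackLevel_iff] at hk'
  rw [mem_pullbackLevel_iff, heckeLevel_val, Subgroup.mem_inf, Subgroup.mem_map]
  refine ⟨⟨⟨φ k', hk'.1, ?_⟩, hK₀ (Subgroup.mem_map_of_mem φ hk₀)⟩, hk₀⟩
  simp only [MulEquiv.coe_toMonoidHom, MulAut.conj_apply, map_mul, map_inv]

/-- The level condition transfers along `φ` for elements of `K₀`: if `(φ g)⁻¹ L (φ g) ⊆ K` and `g ∈ K₀` then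
`g⁻¹ (φ⁻¹L ∩ K₀) g ⊆ φ⁻¹K ∩ K₀`. [cite: Milne2005ShimuraVarieties, §13 p. 118 L21–26] -/
theorem heckeLE_pullbackLevel_of_mem {g : H} (hg : g ∈ K₀.1) {L K : SmallLevel K₀'} (h : HeckeLE (φ g) L K) :
    HeckeLE g (pullbackLevel φ hφ K₀ L) (pullbackLevel φ hφ K₀ K) := by
  intro k hk
  rw [mem_pullbackLevel_iff] at hk ⊢
  refine ⟨?_, K₀.1.mul_mem (K₀.1.mul_mem (K₀.1.inv_mem hg) hk.2) hg⟩
  rw [map_mul, map_mul, map_inv]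
  exact h (φ k) hk.1

end C5

/-! ## §2 Morphisms of towers over `E` along `φ` (the geometric receptacle) -/

section Sec42

variable {F E : Type} [Field F] [NumberField F] [IsTotallyReal F] [Field E] [NumberField E] [Algebra F E]
  [IsTotallyComplex E] [Algebra.IsQuadraticExtension F E]
variable {P5ₛ P5 : PropC5Data F E} {isoₛ iso : ℕ → Prop}

/-- **A morphism of towers `{X⋆_{K⋆}}_{K⋆} → {X_K}_K` over `E` along a continuous group map `φ : G⋆(𝔸_F^∞) → G(𝔸_F^∞)`,
compatible with the Hecke translates** — the receptacle for [Milne2005ShimuraVarieties] Thm. 13.6 («a morphism of Shimura data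
induces morphisms `Sh_{K⋆}(G⋆, X⋆) → Sh_K(G, X)` of the canonical models for `φ(K⋆) ⊆ K`, compatible with the action of
`G(𝔸_f)`»; [Deligne1971TravauxShimura] 5.4) between the compactified systems `X = S̃h` of two §4.2 data over the same `E`
([Liu2021] §4.2 l. 2062–2074), the object that step (S5) of the printed proof of [Liu2021] Thm. 4.15 restricts along (for the
sub-datum `U(V⋆) × U(V⋆^⊥) ↪ U(V)`, proof of Thm. 4.18 l. 2258–2290).  DATA: for every sufficiently small `K ⊆ K₀` of `G`,
an `E`-morphism `map K : X⋆_{φ⁻¹K ∩ K₀⋆} ⟶ X_K` from the CANONICAL source level `C5.pullbackLevel`; LAW: compatibility with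
every admissible pair of translates, `map L ≫ T_{φ g} = T⋆_g ≫ map K`.  A hypothesis structure: nothing asserted; a consumer
takes `(M : Sec42Data.TowerHom Cₛ C Tₛ T φ hφ)`. [cite: Milne2005ShimuraVarieties, Rem. 13.8 p. 119, Thm. 13.6 p. 118 and §5 p. 57–58]
[cite: Deligne1971TravauxShimura, §5 (5.4)] [cite: Liu2021, §4.2 l. 2062–2074 and Thm. 4.18 proof l. 2258–2290] -/
structure Sec42Data.TowerHom (Cₛ : Sec42Data P5ₛ isoₛ) (C : Sec42Data P5 iso) (Tₛ : Cₛ.HeckeTranslates)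
    (T : C.HeckeTranslates) (φ : Cₛ.G →* C.G) (hφ : Continuous φ) : Type where
  /-- `Sh(φ)_K : X⋆_{φ⁻¹K ∩ K₀⋆} ⟶ X_K`, an `E`-morphism, for every sufficiently small `K` ([Milne05] Thm. 13.6). -/
  map : ∀ K : C5.SmallLevel C.S.K₀, Cₛ.X (C5.pullbackLevel φ hφ Cₛ.S.K₀ K) ⟶ C.X K
  /-- Compatibility with the Hecke translates («compatible with the action of `G(𝔸_f)`», [Milne05] Thm. 13.6; at `g = 1`:
  with the transition morphisms), for every `g ∈ G⋆(𝔸_F^∞)`, every admissible target pair `(φ g)⁻¹ L (φ g) ⊆ K` and EVERY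
  admissible source level `L⋆ ⊆ φ⁻¹L ∩ K₀⋆` of `T⋆_g` into `φ⁻¹K ∩ K₀⋆` (the source may have to be refined below `φ⁻¹L ∩ K₀⋆`,
  levels being confined to `K₀⋆`): `u⋆ ≫ map L ≫ T_{φ g} = T⋆_g ≫ map K`. -/
  map_tr : ∀ (g : Cₛ.G) (L K : C5.SmallLevel C.S.K₀) (h : C5.HeckeLE (φ g) L K)
    (Lₛ : C5.SmallLevel Cₛ.S.K₀) (hₛ : C5.HeckeLE g Lₛ (C5.pullbackLevel φ hφ Cₛ.S.K₀ K))
    (hL : Lₛ ≤ C5.pullbackLevel φ hφ Cₛ.S.K₀ L),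
    Cₛ.cpt.X.map (homOfLE hL) ≫ map L ≫ T.tr (φ g) L K h = Tₛ.tr g Lₛ _ hₛ ≫ map K

namespace Sec42Data.TowerHom

variable {Cₛ : Sec42Data P5ₛ isoₛ} {C : Sec42Data P5 iso} {Tₛ : Cₛ.HeckeTranslates} {T : C.HeckeTranslates}
  {φ : Cₛ.G →* C.G} {hφ : Continuous φ} (M : Sec42Data.TowerHom Cₛ C Tₛ T φ hφ)

/-- The source level of `map K`, `K⋆(K) := φ⁻¹K ∩ K₀⋆` (abbreviation). [cite: Milne2005ShimuraVarieties, Rem. 13.8 p. 119 and Thm. 13.6 p. 118] -/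
abbrev src (_M : Sec42Data.TowerHom Cₛ C Tₛ T φ hφ) (K : C5.SmallLevel C.S.K₀) : C5.SmallLevel Cₛ.S.K₀ :=
  C5.pullbackLevel φ hφ Cₛ.S.K₀ K

/-- `map_tr` with the canonical source level `φ⁻¹L ∩ K₀⋆` itself (when it is admissible for `T⋆_g`):
`map L ≫ T_{φ g} = T⋆_g ≫ map K`. [cite: Milne2005ShimuraVarieties, Rem. 13.8 p. 119 and Thm. 13.6 p. 118] -/
theorem map_tr_src (g : Cₛ.G) (L K : C5.SmallLevel C.S.K₀) (h : C5.HeckeLE (φ g) L K)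
    (hₛ : C5.HeckeLE g (M.src L) (M.src K)) :
    M.map L ≫ T.tr (φ g) L K h = Tₛ.tr g _ _ hₛ ≫ M.map K := by
  have key := M.map_tr g L K h (M.src L) hₛ le_rfl
  rwa [show (homOfLE (le_rfl : M.src L ≤ M.src L)) = 𝟙 _ from homOfLE_refl _, Cₛ.cpt.X.map_id,
    Category.id_comp] at key

/-- **Compatibility with the transition morphisms**: for `L ⊆ K`, `map L ≫ u^L_K = u⋆ ≫ map K` (`map_tr` at `g = 1`,
`T_1 = u` on both sides). [cite: Milne2005ShimuraVarieties, §5 p. 58 L3–6 and Rem. 13.8 p. 119] -/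
theorem map_comm {L K : C5.SmallLevel C.S.K₀} (f : L ⟶ K) :
    M.map L ≫ C.cpt.X.map f =
      Cₛ.cpt.X.map (homOfLE (C5.pullbackLevel_mono φ hφ f.le)) ≫ M.map K := by
  have h : C5.HeckeLE (φ 1) L K := by rw [map_one]; exact C5.HeckeLE.one_of_le f.le
  have key := M.map_tr_src 1 L K h (C5.heckeLE_one_pullbackLevel φ hφ f.le)
  rw [T.tr_congr (map_one φ) h (C5.HeckeLE.one_of_le f.le), T.tr_one f, Tₛ.tr_one] at key
  exact key

/-- **`Alb(Sh(φ)_K) : A⋆_{φ⁻¹K ∩ K₀⋆} ⟶ A_K`** — the homomorphism of Albanese varieties over `E` induced by `map K`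
(★ `Albanese.map`, [Liu2021] Def. 2.3 «the induced morphism `Alb_u` by the universal property»): the map through which (S5)
restricts `H¹_ét`. [cite: Liu2021, Def. 2.3 l. 1206–1208 and §4.2 l. 2066–2074] -/
def albMap (K : C5.SmallLevel C.S.K₀) : Cₛ.A (M.src K) ⟶ C.A K :=
  (Cₛ.alb (M.src K)).map (C.alb K) (M.map K)

/-- The printed identity for `Alb(Sh(φ)_K)`: `α⋆ ≫ Alb(map K) = ∇(map K) ≫ α` (Def. 2.3 l. 1207, ★ `Albanese.α_map`).
[cite: Liu2021, Def. 2.3 l. 1206–1208] -/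
theorem α_albMap (K : C5.SmallLevel C.S.K₀) :
    (Cₛ.alb (M.src K)).α ≫ (M.albMap K).hom.hom.hom =
      (Cₛ.alb (M.src K)).nabla.map (C.alb K).nabla (M.map K) ≫ (C.alb K).α :=
  Albanese.α_map _ _ _

/-- **`Alb` of the Hecke compatibility**: `Alb_{u⋆} ≫ Alb(map L) ≫ Alb(T_{φ g}) = Alb(T⋆_g) ≫ Alb(map K)` for every
admissible source level (★ `Albanese.map_comp` on `map_tr`; `Atr = Alb(u)` by ★ `Sec42Data.Atr_eq_map`).
[cite: Liu2021, §4.2 l. 2070–2074] [cite: Milne2005ShimuraVarieties, Rem. 13.8 p. 119 and Thm. 13.6 p. 118] -/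
theorem albMap_albTr (g : Cₛ.G) (L K : C5.SmallLevel C.S.K₀) (h : C5.HeckeLE (φ g) L K)
    (Lₛ : C5.SmallLevel Cₛ.S.K₀) (hₛ : C5.HeckeLE g Lₛ (M.src K)) (hL : Lₛ ≤ M.src L) :
    Cₛ.Atr (homOfLE hL) ≫ M.albMap L ≫ T.albTr (φ g) L K h = Tₛ.albTr g Lₛ _ hₛ ≫ M.albMap K := by
  rw [albMap, albMap, Sec42Data.HeckeTranslates.albTr, Sec42Data.HeckeTranslates.albTr, Cₛ.Atr_eq_map,
    ← Albanese.map_comp, ← Albanese.map_comp, ← Albanese.map_comp, M.map_tr g L K h Lₛ hₛ hL]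

/-- `Alb(map L) ≫ Alb(T_{φ g}) = Alb(T⋆_g) ≫ Alb(map K)` with the canonical source level (★ `Albanese.map_comp` on `map_tr_src`).
[cite: Liu2021, §4.2 l. 2070–2074] -/
theorem albMap_albTr_src (g : Cₛ.G) (L K : C5.SmallLevel C.S.K₀) (h : C5.HeckeLE (φ g) L K)
    (hₛ : C5.HeckeLE g (M.src L) (M.src K)) :
    M.albMap L ≫ T.albTr (φ g) L K h = Tₛ.albTr g _ _ hₛ ≫ M.albMap K := by
  rw [albMap, albMap, Sec42Data.HeckeTranslates.albTr, Sec42Data.HeckeTranslates.albTr, ← Albanese.map_comp,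
    ← Albanese.map_comp, M.map_tr_src g L K h hₛ]

/-- `Alb(map L) ≫ Alb_u = Alb_{u⋆} ≫ Alb(map K)` for `L ⊆ K` (★ `Albanese.map_comp` on `map_comm`, `Atr = Alb(u)` by
★ `Sec42Data.Atr_eq_map`). [cite: Liu2021, §4.2 l. 2070] -/
theorem albMap_Atr {L K : C5.SmallLevel C.S.K₀} (f : L ⟶ K) :
    M.albMap L ≫ C.Atr f = Cₛ.Atr (homOfLE (C5.pullbackLevel_mono φ hφ f.le)) ≫ M.albMap K := by
  rw [albMap, albMap, C.Atr_eq_map f, Cₛ.Atr_eq_map, ← Albanese.map_comp, ← Albanese.map_comp, M.map_comm f]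

/-- **The level pull-back on `H¹_ét`**: `ᵗV_ℓ(Alb(map K)) : H¹_ét(A_K) → H¹_ét(A⋆_{φ⁻¹K ∩ K₀⋆})` (the dual of the tree's
`rationalTateModuleMap`, exactly as the transition maps `etSys`). [cite: Liu2021, §4.3 l. 2152–2160 and Thm. 4.18 proof l. 2258–2262] -/
def etPullLevel (ℓ : ℕ) [Fact ℓ.Prime] (K : C5.SmallLevel C.S.K₀) :
    C.etaleH1 ℓ K →ₗ[ℚ_[ℓ]] Cₛ.etaleH1 ℓ (M.src K) :=
  (rationalTateModuleMap ℓ (M.albMap K)).dualMap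

/-- Unfolding: `(etPullLevel ψ) v = ψ (V_ℓ(Alb(map K)) v)`. [cite: Liu2021, §4.3 l. 2158] -/
theorem etPullLevel_apply (ℓ : ℕ) [Fact ℓ.Prime] (K : C5.SmallLevel C.S.K₀) (ψ : C.etaleH1 ℓ K)
    (v : (Cₛ.A (M.src K)).rationalTateModule ℓ) :
    M.etPullLevel ℓ K ψ v = ψ (rationalTateModuleMap ℓ (M.albMap K) v) := rfl

/-- The level pull-back is `Γ_E`-equivariant (it comes from a homomorphism of abelian varieties over `E`; ★
`rationalTateRep_rationalTateModuleMap`, dualised). [cite: Liu2021, §4.3 l. 2158–2160] -/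
theorem etaleH1Rep_comp_etPullLevel (ℓ : ℕ) [Fact ℓ.Prime] (K : C5.SmallLevel C.S.K₀) (σ : Field.absoluteGaloisGroup E) :
    Cₛ.etaleH1Rep ℓ (M.src K) σ ∘ₗ M.etPullLevel ℓ K = M.etPullLevel ℓ K ∘ₗ C.etaleH1Rep ℓ K σ := by
  apply LinearMap.ext
  intro ψ
  apply LinearMap.ext
  intro v
  simp only [LinearMap.coe_comp, Function.comp_apply, etPullLevel_apply, Representation.dual_apply,
    Module.Dual.transpose_apply, LinearMap.coe_comp, Function.comp_apply]
  rw [rationalTateRep_rationalTateModuleMap]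

end Sec42Data.TowerHom

/-! ## §3 The pull-back on the `ℓ`-adic towers (the étale receptacle) -/

/-- **A morphism of towers WITH ITS PULL-BACK ON `H¹_ét(A_∞)`** — the geometric datum `Sec42Data.TowerHom` together with, for
every prime `ℓ`, a `ℚ_ℓ`-linear map `etPull ℓ : H¹_ét(A_∞ ⊗_E Ē, ℚ_ℓ) → H¹_ét(A⋆_∞ ⊗_E Ē, ℚ_ℓ)` («the following map …» of
[Liu2021] Thm. 4.18 proof l. 2258–2262, restricted along the sub-datum in step (S5) of Thm. 4.15's proof) subject to TWO
laws … in fact ONE law: the DEFINING SQUARE with the level pull-backs `ᵗV_ℓ(Alb(map K))` (`etPull_toTower`).  Neither the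
`Γ_E`-EQUIVARIANCE nor the HECKE INTERTWINING («compatible with the action of `G(𝔸_f)`», [Milne05] Thm. 13.6) is posited: both are
THEOREMS below (`etPull_towerRep`; `etPull_etHeckeRep`, from `map_tr` with refined source levels, granted the threshold
compatibility `φ(K₀⋆) ⊆ K₀`), and the square pins `etPull` (`etPull_unique`).  A hypothesis structure: nothing asserted. [cite: Liu2021, §4.3 l. 2152–2160 and Thm. 4.18 proof l. 2258–2290]
[cite: Milne2005ShimuraVarieties, Rem. 13.8 p. 119 and Thm. 13.6 p. 118] -/
structure Sec42Data.EtaleTowerHom (Cₛ : Sec42Data P5ₛ isoₛ) (C : Sec42Data P5 iso) (Tₛ : Cₛ.HeckeTranslates)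
    (T : C.HeckeTranslates) (φ : Cₛ.G →* C.G) (hφ : Continuous φ)
    extends Sec42Data.TowerHom Cₛ C Tₛ T φ hφ where
  /-- The pull-back `H¹_ét(A_∞) → H¹_ét(A⋆_∞)` on the colimits, for every `ℓ`. -/
  etPull : ∀ (ℓ : ℕ) [Fact ℓ.Prime], C.etaleH1Tower ℓ →ₗ[ℚ_[ℓ]] Cₛ.etaleH1Tower ℓ
  /-- DEFINING SQUARE: `etPull [ψ]_K = [ᵗV_ℓ(Alb(map K)) ψ]_{φ⁻¹K ∩ K₀⋆}` for every small `K` and `ψ ∈ H¹_ét(A_K)`. -/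
  etPull_toTower : ∀ (ℓ : ℕ) [Fact ℓ.Prime] (K : C5.SmallLevel C.S.K₀) (ψ : C.etaleH1 ℓ K),
    etPull ℓ (C.toTower ℓ K ψ) =
      Cₛ.toTower ℓ (C5.pullbackLevel φ hφ Cₛ.S.K₀ K)
        ((rationalTateModuleMap ℓ ((Cₛ.alb (C5.pullbackLevel φ hφ Cₛ.S.K₀ K)).map (C.alb K) (map K))).dualMap ψ)

namespace Sec42Data.EtaleTowerHom

variable {Cₛ : Sec42Data P5ₛ isoₛ} {C : Sec42Data P5 iso} {Tₛ : Cₛ.HeckeTranslates} {T : C.HeckeTranslates}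
  {φ : Cₛ.G →* C.G} {hφ : Continuous φ} (M : Sec42Data.EtaleTowerHom Cₛ C Tₛ T φ hφ) (ℓ : ℕ) [Fact ℓ.Prime]

/-- The defining square in terms of `TowerHom.etPullLevel`: `etPull [ψ]_K = [etPullLevel K ψ]_{φ⁻¹K ∩ K₀⋆}`.
[cite: Liu2021, §4.3 l. 2158 and Thm. 4.18 proof l. 2258–2262] -/
theorem etPull_toTower' (K : C5.SmallLevel C.S.K₀) (ψ : C.etaleH1 ℓ K) :
    M.etPull ℓ (C.toTower ℓ K ψ) = Cₛ.toTower ℓ (M.src K) (M.etPullLevel ℓ K ψ) :=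
  M.etPull_toTower ℓ K ψ

/-- **`Γ_E`-EQUIVARIANCE of the pull-back (a THEOREM, not a field)**: `etPull ∘ σ = σ ∘ etPull` on `H¹_ét(A_∞)` — every
class is a level class (★ `exists_eq_toTower`), the square moves it to a level, the level pull-back is equivariant
(`etaleH1Rep_comp_etPullLevel`), and `σ` commutes with `[·]_K` on both towers (★ `towerRep_toTower`).
[cite: Liu2021, §4.3 l. 2158–2160 and Thm. 4.18 proof l. 2258–2262] -/
theorem etPull_towerRep (σ : Field.absoluteGaloisGroup E) :
    M.etPull ℓ ∘ₗ C.towerRep ℓ σ = Cₛ.towerRep ℓ σ ∘ₗ M.etPull ℓ := by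
  apply LinearMap.ext
  intro x
  obtain ⟨K, ψ, rfl⟩ := C.exists_eq_toTower ℓ x
  rw [LinearMap.comp_apply, LinearMap.comp_apply, C.towerRep_toTower, M.etPull_toTower', M.etPull_toTower',
    Cₛ.towerRep_toTower]
  congr 1
  exact (LinearMap.congr_fun (M.etaleH1Rep_comp_etPullLevel ℓ K σ) ψ).symm

/-- Pointwise form of the `Γ_E`-equivariance. [cite: Liu2021, §4.3 l. 2160] -/
theorem etPull_towerRep_apply (σ : Field.absoluteGaloisGroup E) (x : C.etaleH1Tower ℓ) :
    M.etPull ℓ (C.towerRep ℓ σ x) = Cₛ.towerRep ℓ σ (M.etPull ℓ x) :=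
  LinearMap.congr_fun (M.etPull_towerRep ℓ σ) x

/-- **HECKE INTERTWINING of the pull-back (a THEOREM, not a field)**: `etPull ((φ g) · x) = g · (etPull x)` for the actions
on `H¹_ét(A_∞)`, `H¹_ét(A⋆_∞)` induced by the translates (★ `HeckeTranslates.etHeckeRep`), granted the threshold compatibility
`φ(K₀⋆) ⊆ K₀`.  Proof: write `x = [ψ]_K` (★ `exists_eq_toTower`); `(φ g) · [ψ]_K = [ᵗV_ℓ(Alb T_{φ g}) ψ]_L` with
`L = (φ g)K(φ g)⁻¹ ∩ K₀` (★ `etHeckeRep_toTower`, ★ `heckeLevel`); the square moves it to `φ⁻¹L ∩ K₀⋆` and a transition to the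
refinement `L⋆ = g(φ⁻¹K ∩ K₀⋆)g⁻¹ ∩ K₀⋆ ⊆ φ⁻¹L ∩ K₀⋆` (`heckeLevel_pullbackLevel_le`, ★ `toTower_pull`); on the other side
`g · [ᵗV_ℓ(Alb(map K)) ψ]_{φ⁻¹K ∩ K₀⋆} = [… ]_{L⋆}`; the two level forms agree by `Alb` of `map_tr` (`albMap_albTr`) and the
contravariant functoriality of `ᵗV_ℓ` (★ `dualMap_rationalTateModuleMap_comp_apply`). [cite: Milne2005ShimuraVarieties, Rem. 13.8 p. 119 and Thm. 13.6 p. 118]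
[cite: Liu2021, §4.3 l. 2160 and Thm. 4.18 proof l. 2258–2290] -/
theorem etPull_etHeckeRep_apply (hK₀ : (Cₛ.S.K₀.1 : Subgroup Cₛ.G).map φ ≤ C.S.K₀.1) (g : Cₛ.G) (x : C.etaleH1Tower ℓ) :
    M.etPull ℓ (T.etHeckeRep ℓ (φ g) x) = Tₛ.etHeckeRep ℓ g (M.etPull ℓ x) := by
  obtain ⟨K, ψ, rfl⟩ := C.exists_eq_toTower ℓ x
  have h : C5.HeckeLE (φ g) (C5.heckeLevel (φ g) K) K := C5.heckeLE_heckeLevel (φ g) K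
  have hₛ : C5.HeckeLE g (C5.heckeLevel g (M.src K)) (M.src K) := C5.heckeLE_heckeLevel g (M.src K)
  have hL : C5.heckeLevel g (M.src K) ≤ M.src (C5.heckeLevel (φ g) K) :=
    C5.heckeLevel_pullbackLevel_le φ hφ hK₀ g K
  rw [T.etHeckeRep_toTower ℓ (φ g) h ψ, M.etPull_toTower', M.etPull_toTower', Tₛ.etHeckeRep_toTower ℓ g hₛ,
    ← Cₛ.toTower_pull ℓ (homOfLE hL)]
  congr 1
  rw [Sec42Data.TowerHom.etPullLevel, Sec42Data.TowerHom.etPullLevel, dualMap_rationalTateModuleMap_comp_apply,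
    dualMap_rationalTateModuleMap_comp_apply, dualMap_rationalTateModuleMap_comp_apply, Category.assoc,
    M.albMap_albTr g _ K h _ hₛ hL]

/-- The Hecke intertwining as an identity of linear maps: `etPull ∘ₗ (φ g)· = g· ∘ₗ etPull`.
[cite: Milne2005ShimuraVarieties, Rem. 13.8 p. 119 and Thm. 13.6 p. 118] -/
theorem etPull_etHeckeRep (hK₀ : (Cₛ.S.K₀.1 : Subgroup Cₛ.G).map φ ≤ C.S.K₀.1) (g : Cₛ.G) :
    M.etPull ℓ ∘ₗ T.etHeckeRep ℓ (φ g) = Tₛ.etHeckeRep ℓ g ∘ₗ M.etPull ℓ :=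
  LinearMap.ext fun x => M.etPull_etHeckeRep_apply ℓ hK₀ g x

/-- **The square pins the pull-back**: two étale receptacles with the same geometric datum have the same `etPull`
(every class is a level class). [cite: Liu2021, §4.3 l. 2158] -/
theorem etPull_unique (M' : Sec42Data.EtaleTowerHom Cₛ C Tₛ T φ hφ) (hmap : M'.map = M.map) :
    M'.etPull ℓ = M.etPull ℓ := by
  apply LinearMap.ext
  intro x
  obtain ⟨K, ψ, rfl⟩ := C.exists_eq_toTower ℓ x
  rw [M.etPull_toTower, M'.etPull_toTower, hmap]

/-- The pull-back carries `K`-invariant classes (for the action of `φ g`, `g ∈ φ⁻¹K ∩ K₀⋆`) to `(φ⁻¹K ∩ K₀⋆)`-invariant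
classes — the level bookkeeping of (S5). [cite: Liu2021, Thm. 4.18 (1) l. 2239 and proof l. 2258–2290] -/
theorem etHeckeRep_etPull_of_forall (hK₀ : (Cₛ.S.K₀.1 : Subgroup Cₛ.G).map φ ≤ C.S.K₀.1)
    {K : C5.SmallLevel C.S.K₀} {x : C.etaleH1Tower ℓ} (hx : ∀ k ∈ K.1.1, T.etHeckeRep ℓ k x = x) :
    ∀ k ∈ (C5.pullbackLevel φ hφ Cₛ.S.K₀ K).1.1, Tₛ.etHeckeRep ℓ k (M.etPull ℓ x) = M.etPull ℓ x := by
  intro k hk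
  rw [← M.etPull_etHeckeRep_apply ℓ hK₀, hx (φ k) ((C5.mem_pullbackLevel_iff φ hφ K k).1 hk).1]

end Sec42Data.EtaleTowerHom

/-! ## §4 Elaboration checks (KEY done-criterion): the receptacle instantiates for two ARBITRARY §4.2 data side by side, and with
the target the `Sec42Data.ofAlbanese` big datum built from a Shimura system, a compactified system and Albanese data. -/

/-- Two arbitrary data. -/
example (Cₛ : Sec42Data P5ₛ isoₛ) (C : Sec42Data P5 iso) (Tₛ : Cₛ.HeckeTranslates) (T : C.HeckeTranslates)
    (φ : Cₛ.G →* C.G) (hφ : Continuous φ) : Type :=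
  Sec42Data.EtaleTowerHom Cₛ C Tₛ T φ hφ

/-- Target = `Sec42Data.ofAlbanese` (★ `AlbaneseFunctorial`). -/
example (Cₛ : Sec42Data P5ₛ isoₛ) (Tₛ : Cₛ.HeckeTranslates) (two_le_n : 2 ≤ P5.n) (S : IncoherentShimuraSystem P5)
    (hproj : ∀ K, Literature.AlgebraicGeometry.Motives.IsProjectiveOver (S.Sh𝕍.obj K) ↔
      ¬ (Module.finrank ℚ F = 1 ∧ (3 ≤ P5.n ∨ (P5.n = 2 ∧ ∀ p : ℕ, p.Prime → iso p))))
    (cpt : CompactifiedSystem S) (alb : ∀ K : C5.SmallLevel S.K₀, Albanese (cpt.X.obj K))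
    (T : (Sec42Data.ofAlbanese (isotropicAt := iso) two_le_n S hproj cpt alb).HeckeTranslates)
    (φ : Cₛ.G →* (Sec42Data.ofAlbanese (isotropicAt := iso) two_le_n S hproj cpt alb).G) (hφ : Continuous φ) : Type :=
  Sec42Data.EtaleTowerHom Cₛ (Sec42Data.ofAlbanese (isotropicAt := iso) two_le_n S hproj cpt alb) Tₛ T φ hφ

/-
INTENDED EXISTENCE STATEMENT (typer row T2-R2, NOT typed here — the rank-2 / product datum is absent from the tree):
for the sub-datum `U(V⋆) × U(V⋆^⊥) ↪ U(V)` of a §4.2 datum `C` (with `V⋆ ⊆ V` of rank 2, signature (1,1) at `τ₁`), once a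
`PropC5Data` `P5⋆` with `P5⋆.G = U(V⋆)(𝔸_F^∞) × U(V⋆^⊥)(𝔸_F^∞)`, a §4.2 datum `C⋆ : Sec42Data P5⋆ iso⋆` with translates `T⋆`,
and the inclusion `φ : C⋆.G →* C.G` (continuous, `φ(K₀⋆) ⊆ K₀`) are typed, T2-R2 states
  `def towerHom_exists_printed … : Prop := Nonempty (Sec42Data.EtaleTowerHom C⋆ C T⋆ T φ hφ)`
([Milne2005ShimuraVarieties] Thm. 13.6; [Deligne1971TravauxShimura] §5 (5.4); for the `H¹_ét` square: functoriality of the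
Albanese and of `V_ℓ`, both ★), against the binders of this file.
-/

end Sec42

end Literature.NumberTheory.Automorphic.Liu2021.AppendixC

end
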